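import Mathlib
import HarnessLib
import HarnessLib.Audit
import Summits.Schanuel.Statement
import Literature.NumberTheory.Transcendental.RoyCriterion
import HarnessLib.Audit.Status.Attr

/-!
Route: PowerMapCalibration

# Route PowerMapCalibration — Roy's small-value criterion on the power face G_m^2 (z^beta) —
calibrating the method behind Conjecture 2

It suffices to show X = Roy's Conjecture 2 for every rank ℓ (Roy2001; the item is SHARED with route
RoyCriterion, decl
RoyThesisTyped; X ⟺ Schanuel rank by rank is the tree theorem Roy2001_iff_holds). This route
realises card
power-map-roy-calibration: it adds no hypothesis to X but a second, better-instrumented FACE for the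
small-value method that
is meant to prove X — Roy's criterion transplanted from (𝔾ₐ×𝔾ₘ, ∂₀+X₁∂₁, curve (z,e^z)) to (𝔾ₘ², D_β
= X₀∂₀+βX₁∂₁, curve
(e^t,e^{βt}) i.e. w = z^β), β algebraic irrational — with three corrections to the card found while
typing it: the coset
condition is ∃ d ≥ 1 ∃ t, u^d = e^t ∧ v^d = e^{βt} (branch-free; v = (−u)^β qualifies); the
independence hypothesis is
(w, βw, 2πi, 2πiβ) ℚ-linearly independent (u = e^w; "u multiplicatively independent" is refuted by
(2, 2^√2)); the window is
max(1, 3t/2) < min(s₀, 3s₁), max(s₀, s₁+t) < u < (1+t₀+t₁)/2, t = max(t₀,t₁) (the window on which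
the transplanted PROOF of Roy's Theorem 1 works is EMPTY on 𝔾ₘ²; the new one comes from Roy2002 Cor
1.6).
Ladder: PowCriterion(β,ℓ) ⟹ Power-Schanuel(β,ℓ) [trdeg ℚ(e^t, e^{βt}) ≥ ℓ] ⟸ Schanuel; rank 1 =
Gelfond–Schneider and is
provable DIRECTLY now (Liouville + Philippon, both in tree); rank 2 ∋ "2^√2, 3^√2 algebraically
independent" (open; d = 2, beyond LNM1752 Ch.14 Thm 2.9).
Lean: `∀ n, Literature.NumberTheory.Transcendental.RoyCriterion n`

## Assembly
Only the last arrow is logical: RoyConjectureTwo → Schanuel is `fun hR n => (Roy2001_iff_holds n).mp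
(hR n)` (checked in the
planner's Sketch.lean, rc 0). The three cruxes ride as leading hypotheses so that the file records
the calibration chain
"coset detection → power criterion → single-point twin → Conjecture 2 → Schanuel"; they are the
alternative decomposition
(D-0019: separate route sharing the target decl with RoyCriterion), not extra assumptions on X.

Rationale: WHY THIS LINE. Roy's programme (Roy2001 criterion ⟺ Schanuel; estimates Roy2008 𝔾ₘ, Roy2010 𝔾ₐ,
Roy2013 𝔾ₐ×𝔾ₘ at one point, NguyenRoy2016)
has had exactly one two-dimensional test object, the exponential curve, and is stuck below the
conjectural window because its
elimination step needs fewer conditions than coefficients (Roy2013 p.5: τ+sσ<2). On 𝔾ₘ² the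
one-parameter subgroups z^β form
a family whose arithmetic is known at rank 1 (Gelfond–Schneider; tree gelfond_schneider_holds via
baker_holds) and generically
(BaysKirbyWilkie2010), so the same three statement-shapes — Theorem-1 coset detection, the
multi-point criterion, the
single-point estimate — acquire known or sharply comparable truth values, and diffing the two faces
localises obstructions in
the METHOD rather than in Schanuel. Imported areas: two-variable interpolation on semi-cartesian
sets (Roy2002 Thm 1.4 /
Cor 1.6 — the (b)⇒(a) step on 𝔾ₘ² needs its rank-3 case with BOTH periods of (e^z,e^w), whereas the
exponential face
needs only rank 2, a structural difference found here), Diophantine approximation (good scales for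
mθ+k′−kβ, β algebraic),
zero estimates on commutative algebraic groups (Philippon1986, tree Philippon1986_GaGm_holds). What
no prior route does:
RoyCriterion tracks the exponential face only; the negatives index is empty; the card's own T1_β
plan (transplant the tree's
one-variable Prop 3 proof) is shown infeasible and replaced.

RANKED CRUXES. #0 RoyConjectureTwo (target) — Roy's Conjecture 2 for every rank ℓ — for y ℚ-linearly
independent, α ∈ (ℂˣ)^ℓ, Roy-admissible parameters and the small-value hypothesis on D^kP_N at
(Σm_jy_j, Πα_j^m_j), trdeg ℚ(y,α) ≥ ℓ; shared with route RoyCriterion (RoyThesisTyped); equivalent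
to Schanuel rank by rank (tree Roy2001_iff_holds). (why it might fail: X ⟺ Schanuel per rank
(Roy2001_iff_holds), so X fails iff Schanuel does — an algebraic relation between e and π (rank 2,
y=(1,πi)) or another essential counterexample in ecl(∅)ⁿ; open for every rank ≥ 2.) [Roy2001,
arXiv:1801.08765, arXiv:0810.4285]
#2 PowCriterionTwo (crux) — POWER CRITERION, RANK 2 (card C2, corrected). β algebraic irrational;
w₁,w₂ ∈ ℂ with (w₁,w₂,βw₁,βw₂,2πi,2πiβ) ℚ-linearly independent; v₁,v₂ ∈ ℂˣ; u_j := e^w_j; parameters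
power-admissible: max(1,3t/2) < min(s₀,3s₁), max(s₀,s₁+t) < u < (1+t₀+t₁)/2, t = max(t₀,t₁)
(non-empty: (1.36,0.46,0.9,0.9,1.38), (1.05,0.4,0.6,0.6,1.08)). If for all large N some 0 ≠ P_N ∈
ℤ[X₀,X₁] with deg_Xᵢ ≤ N^tᵢ, H ≤ e^N has |D_β^k P_N(u₁^m₁u₂^m₂, v₁^m₁v₂^m₂)| ≤ e^(−N^u) for k ≤
N^s₀, m_j ≤ N^s₁ (D_β^kP(x,y) written as the k-th derivative at 0 of τ ↦ P(xe^τ, ye^βτ)), then trdeg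
ℚ(u₁,u₂,v₁,v₂) ≥ 2. With PowAuxConstruction it yields Power-Schanuel(β,2): trdeg
ℚ(e^w₁,e^w₂,e^βw₁,e^βw₂) ≥ 2, e.g. 2^√2 ⊥ 3^√2 (t = (log 2, log 3)) and 2^√2 ⊥ e^(iπ√2) (t = (log 2,
πi)) — the first over-determined small-value statement with transcendence-degree-2 content, in the d
= 2 configuration of four exponentials. [deps: PowThm1BtoA] [difficulty: open-problem] (why it might
fail: trdeg ≥ 2 has never been extracted from small values in a d=2 configuration: Roy2013 needs
#conditions < #coefficients (τ+sσ<2, p.5), Gel'fond–Philippon criteria need dℓ ≥ 2(d+ℓ) (LNM1752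
Ch.14 Thm 2.9); and if PowThm1BtoA fails on part of the window, (b) can hold at points of trdeg 1
there.) [Roy2013, NesterenkoPhilippon2001, doi:10.1006/jnth.2000.2595, Waldschmidt2004, Gelfond1934]
#3 PowThm1BtoA (crux) — POWER THEOREM 1, hard direction (card T1_β, corrected and re-founded). β
algebraic irrational, (u,v) ∈ (ℂˣ)², parameters with max(1,3t/2) < min(s₀,3s₁) and max(1,3t/2) < u′.
If condition (b)_β holds — for all large N a nonzero P_N with deg ≤ (N^t₀,N^t₁), H ≤ e^N and
|D_β^kP_N(u^m,v^m)| ≤ e^(−N^u′) for k ≤ N^s₀, m ≤ N^s₁ — then the cyclic group of (u,v) meets the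
subgroup φ(ℂ) = (e^t,e^βt): ∃ d ≥ 1 ∃ t, u^d = e^t ∧ v^d = e^βt. Intended proof: Roy2002 Cor 1.6
(semi-cartesian interpolation in ℂ²) for F(z,w) = P_N(e^z,e^w), Σ = ((log u,log v),(2πi,0),(0,2πi)),
W = ℂ(1,β): the projections (θ,1,β), θ = (log v − β log u)/2πi, have rank 3 exactly when the coset
condition FAILS, giving exponent N³ at the good scales of a two-dimensional Lemma 4 (Liouville for β
makes small relations rank ≤ 1 per scale, then Roy's chain argument); bookkeeping: N = M^κ, κ ∈
(max(1/3,t/2), min(s₁,s₀/3)], u′ > 3κ. The one-period / one-variable Lagrange transplant of the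
tree's Prop 3 proof cannot work (its window s₀ > 2t misses every constructible parameter), which is
why both periods are load-bearing. [difficulty: L] (why it might fail: Cor 1.6's exponent min(s, 3 −
rank of the e^−N-small part of ⟨θ,1,β⟩) must equal 3 at scales N = M^κ aligned with (b)'s M; if good
scales cannot be aligned, or c(u,v,β) is used non-uniformly, (b) may hold off the cosets (Roy2002
§7: distribution conditions are necessary in general).) [doi:10.1006/jnth.2000.2595, Roy2001,
Literature.NumberTheory.Transcendental.Roy2001_prop3_holds]
#4 PowOnePointRoyGap (crux) — ROY 2013 TWIN ON 𝔾ₘ² (card C1/C3 made precise — the method calibration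
proper). β algebraic irrational, (ξ,η) ∈ (ℂˣ)², 1 ≤ τ < 2, b > τ, ν > 2 + b − τ + (τ−1)(2−τ)/(b+1−τ)
(Roy's own gap above the Dirichlet exponent 2+b−τ). If for each large D some 0 ≠ P_D ∈ ℤ[X₁,X₂] of
total degree ≤ D and height ≤ exp(D^b) has max over i < 3⌊D^τ⌋ of |D_β^i P_D(ξ,η)| ≤ exp(−D^ν), then
ξ, η ∈ ℚ̄. Roy2013 Thm 1.1 is this statement for 𝒟₁ = ∂₁+X₂∂₂ on 𝔾ₐ×𝔾ₘ; the item asks whether his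
proof (resultant multiplicity §4, interpolation body §6, descent with the distance to the analytic
curve §7) transfers to 𝒟 = X₁∂₁+βX₂∂₂ and the curve z ↦ (ξe^z, ηe^βz) with the SAME gap. Either
answer calibrates crux RoySmallValueDirichletGap of route RoyCriterion (gap method-intrinsic vs
exp-specific). Consistency checked: algebraic points satisfy the hypothesis (Thue–Siegel over
ℚ(β,ξ,η)), Dirichlet works below 2+b−τ, coset points (α₁e^t, α₂e^βt) reach only ν < min(2, 1+b/2) <
2+b−τ. [difficulty: XL] (why it might fail: 𝒟-jets now have coefficients in ℤ[β] (height inflation ≈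
D^τ log D per jet; Liouville over ℚ(β)) and Roy2013 §7's distance estimates use the additive
translation ξ+z; the transferred descent may close only for a strictly larger ν, or not at all near
τ = 2.) [Roy2013, NguyenRoy2016, arXiv:1912.04047, Philippon1986]
#9 PowAuxConstruction (support) — (a)⇒(b) at curve points, every rank ℓ, on the constructible window
max(1,s₀,s₁+t) < u < (1+t₀+t₁)/2: for β algebraic irrational and any t₁…t_ℓ ∈ ℂ, polynomials P_N
(deg ≤ N^tᵢ, H ≤ e^N) exist with |D_β^kP_N| ≤ e^(−N^u) at all points (e^Σm_jt_j, e^βΣm_jt_j), k ≤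
N^s₀, m_j ≤ N^s₁ — Waldschmidt's Thm 3.1 construction for f(z) = P(e^z,e^βz) (Roy2002 Thm 8.1, Cor
8.3(i)/8.5(i)): Siegel on the ℚ-coordinates of the ℤ[β]-valued Taylor coefficients (L ≈
N^((1+t₀+t₁)/2)), Schwarz on the disc of radius N^s₁, Cauchy for k ≤ N^s₀ (cf. tree
exists_royAuxPoly). [difficulty: provable-now] [doi:10.1006/jnth.2000.2595, Waldschmidt1981,
Roy2001]
#9 PowCriterionOne (support) — rank-1 power criterion on the power-admissible window:
(w,βw,2πi,2πiβ) ℚ-independent, v ≠ 0, (b)_β at (e^mw, v^m) ⇒ trdeg ℚ(e^w, v) ≥ 1. Provable now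
WITHOUT PowThm1BtoA — it is Gel'fond's proof of α^β read as a criterion: if e^w, v ∈ ℚ̄, Liouville
over ℚ(β,e^w,v) (uses u > max(1,s₀,s₁+t)) turns the small jets into exact zeros, and Philippon's
zero estimate with multiplicities (tree Philippon1986_GaGm_holds with m = 2, X-degree 0, W =
ℂ(0,1,β), Σ = points m ≤ N^s₁/3) contradicts s₀+s₁ > 2t (case G′ ⊂ 𝔾ₐ×1) and s₀ > t (case G′ ⊃ a
subtorus, transversal to (1,β) since β ∉ ℚ). Its truth value is Gelfond–Schneider's; it is the
rank-1 rung and the definition-bug detector of the ladder. [difficulty: provable-now] [Gelfond1934,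
Philippon1986, Literature.NumberTheory.Transcendental.Philippon1986_GaGm_holds, Roy2001]
#9 PowCriterionImpPowerSchanuel (support) — for every ℓ, PowCriterion(β,ℓ) ⇒ Power-Schanuel(β,ℓ):
given t with (t,βt,2πi,2πiβ) ℚ-independent apply the criterion to w := t, v_j := e^βt_j, whose
hypothesis holds by PowAuxConstruction; hence PowCriterionTwo has the advertised content. The
converse (Power-Schanuel ⇒ criterion: the criterion is not stronger than its Schanuel shadow)
follows from PowThm1BtoA by Roy2001 §5 1° verbatim (lcm of the d_j, t_j = d w_j + 2πin_j stays
(ℚ+ℚβ)-independent thanks to the 2πi-part of the hypothesis) and is left for tenure. [difficulty: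
provable-now] [Roy2001, doi:10.1006/jnth.2000.2595]
#9 PowerSchanuelOfSchanuel (support) — Schanuel ⇒ Power-Schanuel(β,ℓ) for every algebraic irrational
β and every ℓ: apply Schanuel to the 2ℓ numbers (t, βt) and remove t (ℓ generators) and βt
(algebraic over ℚ(t,β)). Certifies that each rung is a Schanuel consequence, so a refutation of
PowCriterionTwo not traced to the window refutes the summit; the generic-power analogue is a theorem
(BaysKirbyWilkie2010 Thm 1.2), the far end of the dial. [difficulty: provable-now] [Lang1966,
Waldschmidt2004, BaysKirbyWilkie2010]
#9 PowerSchanuelOne (support) — Power-Schanuel(β,1): (t,βt,2πi,2πiβ) ℚ-independent ⇒ e^t and e^βt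
are not both algebraic — Gelfond–Schneider in logarithmic form, from the tree fact gelfond_schneider
(PROVED, gelfond_schneider_holds via baker_holds) plus trdeg = 0 ↔ algebraic for a finitely
generated adjoin. [difficulty: provable-now] [Gelfond1934,
Literature.NumberTheory.Transcendental.gelfond_schneider_holds]

TWO-LAYER PLAN. PowThm1BtoA ⇐ GoodScales2D (two-dimensional Lemma 4: for β algebraic and 1,β,θ
ℚ-independent, infinitely many N with no
(m,k,k′) ≠ 0, max ≤ N, |mθ+k′−kβ| < e^−N) → SemiCartesianRank3 (Roy2002 Cor 1.6 for m = 2, s ≥ 3,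
formalised) → PowThm1BtoA.
PowCriterionTwo ⇐ PSImpPowCriterion (converse glue from PowThm1BtoA) → PowerSchanuelTwo (trdeg
ℚ(e^t₁,e^t₂,e^βt₁,e^βt₂) ≥ 2)
→ PowCriterionTwo. PowOnePointRoyGap ⇐ ResultantMultiplicityDβ (Roy2013 §4, derivation-agnostic) →
InterpolationBodyDβ (§6)
→ DescentPowerCurve (§7) → PowOnePointRoyGap. Nothing of this is filed now.

KILL CRITERIA. PowThm1BtoA refuted at some power-admissible tuple ⇒ the window is wrong: REPAIR
(restate PowThm1BtoA/PowCriterionTwo/One with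
the corrected window; the refuting point is itself the first calibration datum). PowThm1BtoA refuted
on the whole constructible
range ⇒ small values do not detect cosets on 𝔾ₘ² at all ⇒ close the route (census) and file the
witness as a barrier note on
RoyCriterion's method cruxes. PowCriterionTwo refuted while PowThm1BtoA and PowAuxConstruction stand
⇒ ¬Power-Schanuel(β,2) ⇒
¬Schanuel (PowerSchanuelOfSchanuel): the summit falls. PowOnePointRoyGap refuted ⇒ Roy2013's gap is
exp-specific — drop the
item (not load-bearing) with a note re-ranking RoySmallValueDirichletGap. X proved or refuted
elsewhere (any rank-by-rank
resolution of Schanuel) moots everything.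

NOT DECOMPOSED YET. The converse glue Power-Schanuel ⇒ PowCriterion (needs PowThm1BtoA); the (a)⇒(b)
construction at genuine cosets (d ≥ 2); the
Dirichlet-edge version of PowOnePointRoyGap (ν > 2+b−τ), twin of RoySmallValueDirichletGap; ranks ≥
3; the joint criterion on
𝔾ₐ×𝔾ₘ² along (t,e^t,e^βt) (found while planning: its window must lie ABOVE the two-variable Siegel
exponents of both faces, so
the faces are not specialisations of it — deferred); a Literature definition file
PowerCriterion.lean (see Definition requests).

CHEAPEST FALSIFIER. Re-derive the four exponent inequalities behind the window (a refuter with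
pencil, 30 min): (i) constructible u < (1+t₀+t₁)/2,
u > max(1,s₀,s₁+t); (ii) Cor-1.6 bookkeeping κ > max(1/3,t/2), κ ≤ min(s₁,s₀/3), u > 3κ; (iii)
Dirichlet infeasibility
s₀+s₁+u ≥ t₀+t₁+1; (iv) zero-estimate s₀+s₁ > 2t, s₀ > t — the planner's derivation gives the sliver
t ∈ (1/2,1),
s₁ ∈ (max(1/3,t/2),1/2), and the tuples above pass all four (Sketch.lean powAdmissible_example by
norm_num). Second: read
Nguyen's thesis (doi:10.20381/ruor-3471) for a 𝔾ₘ²/power remark that would make PowThm1BtoA known or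
known-false. Third:
u a root of unity, v = e^πiβ: coset holds with d = 2 — check any proposed proof of PowThm1BtoA
handles torsion u.

NUMBERS. Roy's window (1): max(1,t₀,2t₁) < min(s₀,2s₁), max(s₀,s₁+t₁) < u < (1+t₀+t₁)/2, e.g.
(1.3,0.7,1.2,0.5,1.32) (tree
royAdmissible_example). Power face: interpolation window max(1,3t/2) < min(s₀,3s₁,u); constructible
window
max(1,s₀,s₁+t) < u < (1+t₀+t₁)/2; their intersection (power-admissible) is non-empty exactly for t ∈
(1/2,1):
(1.36,0.46,0.9,0.9,1.38), (1.22,0.45,0.8,0.8,1.27), (1.05,0.4,0.6,0.6,1.08). The transplant of the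
tree's one-variable Prop 3
proof needs s₀ > t₁+t, s₁ ≥ t₁, u > s₀ — with u < 1/2+t and u > 1 this forces t < 1/2 < t: EMPTY.
Dirichlet count on 𝔾ₘ²:
unknowns N^(t₀+t₁+1) vs conditions N^(s₀+s₁+u). Roy2013 Thm 1.1: 1 ≤ τ < 2, b > τ, ν >
2+b−τ+(τ−1)(2−τ)/(b+1−τ), gap ≤ 1/4;
Dirichlet at every point for ν < 2+b−τ; Khintchine–Philippon obstruction for τ < 1. Roy2008 (𝔾ₘ,
dimension one): gain 5σ/11+τ
vs Dirichlet's mσ+τ. LNM1752 Ch.14 Thm 2.9: t ≥ 2 needs dℓ ≥ 2(d+ℓ) — void for d = 2. Roy2002 Cor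
8.3: for f(z) = P(e^z,e^ξz),
deg P ≤ N, |f|_cN ≥ exp(−c³N²) ((V), optimality of Waldschmidt's construction on 𝔾ₘ²). Items at
open: 10 (1 target,
3 cruxes, 5 support, 1 assembly).

DEFINITION REQUESTS. None needed for elaboration: every item is inline over Mathlib +
Literature.NumberTheory.Transcendental.mvPolyHeight (all ten
signatures elaborate, planner OneLine.lean rc 0, 2026-08-15). Convenience notions for a future
Literature/NumberTheory/Transcendental/PowerCriterion.lean, verbatim from the planner's Sketch.lean
(defeq-checked against the
inlined items by Iff.rfl / simp only): powJet β k P x y := iteratedDeriv k (fun τ ↦ aeval ![x·e^τ,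
y·e^(βτ)] P) 0;
PowAdmissible s₀ s₁ t₀ t₁ u; PowHypothesis β w v …; PowCondB β u v …; PowIndep β w :=
LinearIndependent ℚ (w ⧺ βw ⧺ [2πi, 2πiβ]);
PowCriterion β ℓ; PowerSchanuel β ℓ. To be filed by tenure if provers ask; no cite facts wanted
(Roy2001_iff, gelfond_schneider,
Philippon1986_GaGm are all PROVED in tree).

Novelty: Searches (2026-08-15): `lit citing doi:10.4064/aa97-2-6` (28 local descendants: the programme
papers, surveys, newest
arXiv:1801.08765); `lit citing arXiv:1301.0663` (3: arXiv:1412.5163, Nguyen's thesis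
doi:10.20381/ruor-3471, corpus:14642129);
`lit search --source s2 "small value estimates multiplicative group Roy"` (the 4 programme papers
arXiv:1301.0668, 0708.2307,
1301.0663, 1412.5163, nothing else); `lit search --source crossref` located Roy2002 =
doi:10.1006/jnth.2000.2595, READ in full
for §1 (Thm 1.4, Cor 1.5–1.6) and §8 (Thm 8.1, Prop 8.2, Cor 8.3, Prop 8.4, Cor 8.5); Roy2008
(arXiv:1301.0668) intro read —
dimension one, P ∈ ℤ[T]; Roy2013 pp.2–5 read; `lit frontier Schanuel --since 2018` (30 rows, none on
the programme);
`lit bridges Schanuel --cross any`; `lit search --hybrid` (no held Roy texts); OpenAlex and arXiv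
APIs answered 429 (recorded, not
retried). Card audit (refuter-novelty-audit-10) had already checked Roy2008's setting.
Nearest prior art found: doi:10.1006/jnth.2000.2595 §8 — Waldschmidt's auxiliary function on the
one-parameter subgroups of 𝔾ₘ²,
VALUES on a rank-2 subgroup of the curve (Prop 8.2 via Cor 1.5, exponent N², under Diophantine
conditions (8.1)) and its
optimality for four exponentials (Cor 8.3, statement (V)); Roy2001 (the 𝔾ₐ×𝔾ₘ criterion, tree
Roy2001_iff_holds); Roy2013
Thm 1.1 (single-point estimate on 𝔾ₐ×𝔾ₘ).
Delta: the arithmetic criterion for the power subgroup itself — off-curve data with derivatives,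
whose coset detection needs the  [refs: 10.4064/aa97-2-6`, 10.20381/ruor-3471, 10.1006/jnth.2000.2595, 1801.08765, 1301.0663, 1412.5163, 1301.0668, doi:10.4064/aa97-2-6, doi:10.20381/ruor-3471, doi:10.1006/jnth.2000.2595, Roy2008, Roy2013, Roy2001]

Barriers (technique_class: small-value-estimates, power-subgroup, roy-criterion): - technique_class: small-value-estimates, power-subgroup, roy-criterion
- Literature.Barriers.Schanuel.LargeTranscendenceDegree: APPLIES to PowCriterionTwo — with x = (1,β)
the data form a d = 2 grid where smallTrdeg_thm_2_9_pos gives nothing beyond trdeg 1 and Thm 2.7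
needs the Technical Hypothesis; it does not evade it; the bet (Roy's) is that over-determined
small-value data (s₀+s₁ > 2t) carry transcendence degree without T.H.; the near-term items
PowThm1BtoA, PowCriterionOne, PowOnePointRoyGap do not have to cross it.
- Literature.Barriers.Schanuel.LinearSubgroupMethodLimit: not in class (no linear embedding into
M_(d,l)(r), no Thm 1.2); PowCriterionTwo's consequences (2^√2 ⊥ 3^√2) have four-exponentials flavour
with an algebraic corner, and roy1995_thm_3_4's no-go is printed for LST embeddings only (scope
caveat).
- Literature.Barriers.Schanuel.AlgebraicIndependenceOfLogarithms: consistent — Power-Schanuel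
concludes independence of exponentials e^t, e^βt only; the shared target X ⟺ Schanuel accepts the
barrier in full exactly as RoyCriterion does.
- Literature.Barriers.Schanuel.AxSchanuelFunctionalNotNumerical: the generic-power theorem
baysKirbyWilkie2010_thm_1_2 is used only as an oracle that the ladder is true at the far end of the
dial; every item here is archimedean (heights, |D_β^kP| ≤ e^−N^u), outside the functional class.
- Literature.Barriers.Schanuel.AxiomsDoNotForceSchanuel: n/a — no first-order/axiomatic transfer is
used.
- Literature.Barriers.Schanuel.Schanu

Novelty grade: variant — ROUTE REVIEW refuter-rreview dc4d2026 gen3 (2026-08-15, delta pass; gen0 did the full review, gen2 added prover notes on 6721/6723). (1) Module builds: Probe3.lean rc0, all 10 decls resolve; all items carry gen0 check stamps + g13-36 grounding; candidate proofs attached for Assembly 8196 (PowerMapCa (refuter refuter-rreview-route-CriticalPhenomena--dc4d2026-g3-0, 2026-08-15T14:58:46Z; prior: Roy2001 (doi:10.4064/aa97-2-6), Roy2002 (doi:10.1006/jnth.2000.2595) §8, Roy2013 (arXiv:1301.0663) Thm 1.1, route-Schanuel-RoyCriterion)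

History (route lifecycle, newest last):
- 2026-08-15T12:32:21Z · rev 1: restated Assembly (stmt-Schanuel-6724) — restate Assembly with the shared target expanded inline (robust to the shared item's decl naming); also a re-render attempt: rev 0 file never materialised after (planner-plancard-Schanuel-Schanuel-power-map--5d7db28c-0)
- 2026-08-16T02:18:11Z · AUTO-CRUX: 1 conjecture-grade item(s) promoted to crux (RoyConjectureTwo) — refuter vetting / tiering apply (operator:999:1362873)
- 2026-08-16T04:17:14Z · AUTO-CRUX (backfill): RoyConjectureTwo — hypotheses of the deciding theorem that nothing in the route derives are cruxes (operator:999:1085951)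
- 2026-08-21T10:00:43Z · DORMANT — reconciler: no traction for 5 d (last activity statement-claimed at 2026-08-16T09:32:26Z); parked, not closed — `ledger route dormant route-Schanuel-PowerMapCal (operator:999:1288583)
- 2026-08-31T08:41:45Z · REACTIVATED (open) — reconciler: reactivated — activity statement-checked at 2026-08-31T07:27:23Z after parking at 2026-08-21T10:00:43Z (operator:999:760766)

sub-problem: Schanuel · status: open · opened planner-plancard-Schanuel-Schanuel-power-map--5d7db28c-0 2026-08-15T11:51:06Z · rev 2 · ledger route-Schanuel-PowerMapCalibration
GENERATED by the gate from the ledger (D-0016/17). Provers cite these decls: `theorem foo : Summit.Schanuel.Schanuel.Theses.PowerMapCalibration.<Decl> := …` in Summits/Schanuel/Schanuel/Theorems/<Name>.lean.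
-/

namespace Summit.Schanuel.Schanuel.Theses.PowerMapCalibration

open scoped BigOperators Topology Manifold Classical MeasureTheory ProbabilityTheory Matrix InnerProductSpace ComplexConjugate ContinuousMap
open Filter Set Function TopologicalSpace MeasureTheory

attribute [summit_statement] _root_.Schanuel

open Literature.Periods

/-- item stmt-Schanuel-0078 · crux (kind.auto-crux: conjecture-grade) · rank 0 · open · by planner
why it might fail: X ⟺ Schanuel per rank (Roy2001_iff_holds), so X fails iff Schanuel does — an algebraic relation between e and π (rank 2, y=(1,πi)) or another essential counterexample in ecl(∅)ⁿ; open for every rank ≥ 2.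
sources: Roy2001, arXiv:1801.08765, arXiv:0810.4285
∀ n, RoyCriterion n. Roy2001 Conjecture 1: y₁..yₙ ∈ ℂ ℚ-lin. independent, α₁..αₙ ∈ ℂˣ, reals
s₀,s₁,t₀,t₁,u>0 with max(1,t₀,2t₁) < min(s₀,2s₁), max(s₀,s₁+t₁) < u < (1+t₀+t₁)/2; if for all large
N there is 0≠P_N∈ℤ[X₀,X₁], deg_X₀ ≤ N^t₀, deg_X₁ ≤ N^t₁, height ≤ e^N, with |D^k P_N(Σ m_j y_j, Π
α_j^{m_j})| ≤ exp(−N^u) for 0≤k≤N^s₀, 0≤m_j≤N^s₁ (D = ∂/∂X₀ + X₁∂/∂X₁), then trdeg_ℚ ℚ(y,α) ≥ n.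
Elaborating Lean sketch RoyCriterionSketch/royD in planner folder routes/RoyCriterion/Sketch.lean.
GROUNDER: verify window and N-quantifier against Roy2001 §1. Sources: Roy2001. [needs_definition:
RoyCriterion] -/
@[route_item "route-Schanuel-PowerMapCalibration", crux]
def RoyConjectureTwo : Prop :=
  ∀ n, Literature.NumberTheory.Transcendental.RoyCriterion n

/-- item stmt-Schanuel-6716 · crux · rank 2 · open · by planner
why it might fail: trdeg ≥ 2 has never been extracted from small values in a d=2 configuration: Roy2013 needs #conditions < #coefficients (τ+sσ<2, p.5), Gel'fond–Philippon criteria need dℓ ≥ 2(d+ℓ) (LNM1752 Ch.14 Thm 2.9); and if PowThm1BtoA fails on part of the window, (b) can hold at points of trdeg 1 there.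
sources: Roy2013, NesterenkoPhilippon2001, doi:10.1006/jnth.2000.2595, Waldschmidt2004, Gelfond1934
[crux] POWER CRITERION, RANK 2 (card C2, corrected). β algebraic irrational; w₁,w₂ ∈ ℂ with
(w₁,w₂,βw₁,βw₂,2πi,2πiβ) ℚ-linearly independent; v₁,v₂ ∈ ℂˣ; u_j := e^w_j; parameters
power-admissible: max(1,3t/2) < min(s₀,3s₁), max(s₀,s₁+t) < u < (1+t₀+t₁)/2, t = max(t₀,t₁)
(non-empty: (1.36,0.46,0.9,0.9,1.38), (1.05,0.4,0.6,0.6,1.08)). If for all large N some 0 ≠ P_N ∈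
ℤ[X₀,X₁] with deg_Xᵢ ≤ N^tᵢ, H ≤ e^N has |D_β^k P_N(u₁^m₁u₂^m₂, v₁^m₁v₂^m₂)| ≤ e^(−N^u) for k ≤
N^s₀, m_j ≤ N^s₁ (D_β^kP(x,y) written as the k-th derivative at 0 of τ ↦ P(xe^τ, ye^βτ)), then trdeg
ℚ(u₁,u₂,v₁,v₂) ≥ 2. With PowAuxConstruction it yields Power-Schanuel(β,2): trdeg
ℚ(e^w₁,e^w₂,e^βw₁,e^βw₂) ≥ 2, e.g. 2^√2 ⊥ 3^√2 (t = (log 2, log 3)) and 2^√2 ⊥ e^(iπ√2) (t = (log 2,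
πi)) — the first over-determined small-value statement with transcendence-degree-2 content, in the d
= 2 configuration of four exponentials. [deps: PowThm1BtoA] [difficulty: open-problem] -/
@[route_item "route-Schanuel-PowerMapCalibration", crux]
def PowCriterionTwo : Prop :=
  ∀ β : ℂ, IsAlgebraic ℚ β → β ∉ Set.range ((↑) : ℚ → ℂ) → ∀ (w v : Fin 2 → ℂ), LinearIndependent ℚ (Fin.append (Fin.append w (fun j => β * w j)) ![2 * (Real.pi : ℂ) * Complex.I, 2 * (Real.pi : ℂ) * Complex.I * β]) → (∀ j, v j ≠ 0) → ∀ (s₀ s₁ t₀ t₁ u : ℝ), 0 < s₁ → 0 < t₀ → 0 < t₁ → max 1 (3 / 2 * max t₀ t₁) < min s₀ (3 * s₁) → max s₀ (s₁ + max t₀ t₁) < u → u < (1 + t₀ + t₁) / 2 → (∀ᶠ N : ℕ in Filter.atTop, ∃ P : MvPolynomial (Fin 2) ℤ, P ≠ 0 ∧ (P.degreeOf 0 : ℝ) ≤ (N : ℝ) ^ t₀ ∧ (P.degreeOf 1 : ℝ) ≤ (N : ℝ) ^ t₁ ∧ (Literature.NumberTheory.Transcendental.mvPolyHeight P : ℝ)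 ≤ Real.exp N ∧ ∀ (k : ℕ) (m : Fin 2 → ℕ), (k : ℝ) ≤ (N : ℝ) ^ s₀ → (∀ j, (m j : ℝ) ≤ (N : ℝ) ^ s₁) → ‖iteratedDeriv k (fun τ : ℂ => MvPolynomial.aeval ![Complex.exp (∑ j, (m j : ℂ) * w j) * Complex.exp τ, (∏ j, v j ^ m j) * Complex.exp (β * τ)] P) 0‖ ≤ Real.exp (-(N : ℝ) ^ u)) → (2 : Cardinal) ≤ Algebra.trdeg ℚ ↥(IntermediateField.adjoin ℚ (Set.range (Complex.exp ∘ w) ∪ Set.range v))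

/-- item stmt-Schanuel-6717 · crux · rank 3 · open · by planner
why it might fail: Cor 1.6's exponent min(s, 3 − rank of the e^−N-small part of ⟨θ,1,β⟩) must equal 3 at scales N = M^κ aligned with (b)'s M; if good scales cannot be aligned, or c(u,v,β) is used non-uniformly, (b) may hold off the cosets (Roy2002 §7: distribution conditions are necessary in general).
sources: doi:10.1006/jnth.2000.2595, Roy2001, Literature.NumberTheory.Transcendental.Roy2001_prop3_holds
[crux] POWER THEOREM 1, hard direction (card T1_β, corrected and re-founded). β algebraic
irrational, (u,v) ∈ (ℂˣ)², parameters with max(1,3t/2) < min(s₀,3s₁) and max(1,3t/2) < u′. If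
condition (b)_β holds — for all large N a nonzero P_N with deg ≤ (N^t₀,N^t₁), H ≤ e^N and
|D_β^kP_N(u^m,v^m)| ≤ e^(−N^u′) for k ≤ N^s₀, m ≤ N^s₁ — then the cyclic group of (u,v) meets the
subgroup φ(ℂ) = (e^t,e^βt): ∃ d ≥ 1 ∃ t, u^d = e^t ∧ v^d = e^βt. Intended proof: Roy2002 Cor 1.6
(semi-cartesian interpolation in ℂ²) for F(z,w) = P_N(e^z,e^w), Σ = ((log u,log v),(2πi,0),(0,2πi)),
W = ℂ(1,β): the projections (θ,1,β), θ = (log v − β log u)/2πi, have rank 3 exactly when the coset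
condition FAILS, giving exponent N³ at the good scales of a two-dimensional Lemma 4 (Liouville for β
makes small relations rank ≤ 1 per scale, then Roy's chain argument); bookkeeping: N = M^κ, κ ∈
(max(1/3,t/2), min(s₁,s₀/3)], u′ > 3κ. The one-period / one-variable Lagrange transplant of the
tree's Prop 3 proof cannot work (its window s₀ > 2t misses every constructible parameter), which is
why both periods are load-bearing. [difficulty: L] -/
@[route_item "route-Schanuel-PowerMapCalibration", crux]
def PowThm1BtoA : Prop :=
  ∀ β : ℂ, IsAlgebraic ℚ β → β ∉ Set.range ((↑) : ℚ → ℂ) → ∀ (u v : ℂ), u ≠ 0 → v ≠ 0 → ∀ (s₀ s₁ t₀ t₁ u' : ℝ), 0 < s₁ → 0 < t₀ → 0 < t₁ → max 1 (3 / 2 * max t₀ t₁) < min s₀ (3 * s₁) → max 1 (3 / 2 * max t₀ t₁) < u' → (∀ᶠ N : ℕ in Filter.atTop, ∃ P : MvPolynomial (Fin 2) ℤ, P ≠ 0 ∧ (P.degreeOf 0 : ℝ) ≤ (N : ℝ) ^ t₀ ∧ (P.degreeOf 1 : ℝ) ≤ (N : ℝ) ^ t₁ ∧ (Literature.NumberTheory.Transcendental.mvPolyHeight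 P : ℝ) ≤ Real.exp N ∧ ∀ k m : ℕ, (k : ℝ) ≤ (N : ℝ) ^ s₀ → (m : ℝ) ≤ (N : ℝ) ^ s₁ → ‖iteratedDeriv k (fun τ : ℂ => MvPolynomial.aeval ![u ^ m * Complex.exp τ, v ^ m * Complex.exp (β * τ)] P) 0‖ ≤ Real.exp (-(N : ℝ) ^ u')) → ∃ d : ℕ, 1 ≤ d ∧ ∃ t : ℂ, u ^ d = Complex.exp t ∧ v ^ d = Complex.exp (β * t)

/-- item stmt-Schanuel-6718 · crux · rank 4 · open · by planner
why it might fail: 𝒟-jets now have coefficients in ℤ[β] (height inflation ≈ D^τ log D per jet; Liouville over ℚ(β)) and Roy2013 §7's distance estimates use the additive translation ξ+z; the transferred descent may close only for a strictly larger ν, or not at all near τ = 2.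
sources: Roy2013, NguyenRoy2016, arXiv:1912.04047, Philippon1986
[crux] ROY 2013 TWIN ON 𝔾ₘ² (card C1/C3 made precise — the method calibration proper). β algebraic
irrational, (ξ,η) ∈ (ℂˣ)², 1 ≤ τ < 2, b > τ, ν > 2 + b − τ + (τ−1)(2−τ)/(b+1−τ) (Roy's own gap above
the Dirichlet exponent 2+b−τ). If for each large D some 0 ≠ P_D ∈ ℤ[X₁,X₂] of total degree ≤ D and
height ≤ exp(D^b) has max over i < 3⌊D^τ⌋ of |D_β^i P_D(ξ,η)| ≤ exp(−D^ν), then ξ, η ∈ ℚ̄. Roy2013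
Thm 1.1 is this statement for 𝒟₁ = ∂₁+X₂∂₂ on 𝔾ₐ×𝔾ₘ; the item asks whether his proof (resultant
multiplicity §4, interpolation body §6, descent with the distance to the analytic curve §7)
transfers to 𝒟 = X₁∂₁+βX₂∂₂ and the curve z ↦ (ξe^z, ηe^βz) with the SAME gap. Either answer
calibrates crux RoySmallValueDirichletGap of route RoyCriterion (gap method-intrinsic vs
exp-specific). Consistency checked: algebraic points satisfy the hypothesis (Thue–Siegel over
ℚ(β,ξ,η)), Dirichlet works below 2+b−τ, coset points (α₁e^t, α₂e^βt) reach only ν < min(2, 1+b/2) <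
2+b−τ. [difficulty: XL] -/
@[route_item "route-Schanuel-PowerMapCalibration", crux]
def PowOnePointRoyGap : Prop :=
  ∀ β : ℂ, IsAlgebraic ℚ β → β ∉ Set.range ((↑) : ℚ → ℂ) → ∀ (ξ η : ℂ), ξ ≠ 0 → η ≠ 0 → ∀ (b τ ν : ℝ), 1 ≤ τ → τ < 2 → τ < b → 2 + b - τ + (τ - 1) * (2 - τ) / (b + 1 - τ) < ν → (∀ᶠ D : ℕ in Filter.atTop, ∃ P : MvPolynomial (Fin 2) ℤ, P ≠ 0 ∧ P.totalDegree ≤ D ∧ (Literature.NumberTheory.Transcendental.mvPolyHeight P : ℝ) ≤ Real.exp ((D : ℝ) ^ b) ∧ ∀ i : ℕ, i < 3 * ⌊(D : ℝ) ^ τ⌋₊ → ‖iteratedDeriv i (fun s : ℂ => MvPolynomial.aeval ![ξ * Complex.exp s, η * Complex.exp (β * s)] P) 0‖ ≤ Real.exp (-(D : ℝ) ^ ν)) → IsAlgebraic ℚ ξ ∧ IsAlgebraic ℚ η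

/-- item stmt-Schanuel-6719 · support · rank 9 · open · by planner
sources: doi:10.1006/jnth.2000.2595, Waldschmidt1981, Roy2001
[support] (a)⇒(b) at curve points, every rank ℓ, on the constructible window max(1,s₀,s₁+t) < u <
(1+t₀+t₁)/2: for β algebraic irrational and any t₁…t_ℓ ∈ ℂ, polynomials P_N (deg ≤ N^tᵢ, H ≤ e^N)
exist with |D_β^kP_N| ≤ e^(−N^u) at all points (e^Σm_jt_j, e^βΣm_jt_j), k ≤ N^s₀, m_j ≤ N^s₁ —
Waldschmidt's Thm 3.1 construction for f(z) = P(e^z,e^βz) (Roy2002 Thm 8.1, Cor 8.3(i)/8.5(i)):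
Siegel on the ℚ-coordinates of the ℤ[β]-valued Taylor coefficients (L ≈ N^((1+t₀+t₁)/2)), Schwarz on
the disc of radius N^s₁, Cauchy for k ≤ N^s₀ (cf. tree exists_royAuxPoly). [difficulty:
provable-now] -/
@[route_item "route-Schanuel-PowerMapCalibration", crux]
def PowAuxConstruction : Prop :=
  ∀ β : ℂ, IsAlgebraic ℚ β → β ∉ Set.range ((↑) : ℚ → ℂ) → ∀ (l : ℕ) (t : Fin l → ℂ) (s₀ s₁ t₀ t₁ u : ℝ), 0 < s₀ → 0 < s₁ → 0 < t₀ → 0 < t₁ → max 1 (max s₀ (s₁ + max t₀ t₁)) < u → u < (1 + t₀ + t₁) / 2 → ∀ᶠ N : ℕ in Filter.atTop, ∃ P : MvPolynomial (Fin 2) ℤ, P ≠ 0 ∧ (P.degreeOf 0 : ℝ) ≤ (N : ℝ) ^ t₀ ∧ (P.degreeOf 1 : ℝ) ≤ (N : ℝ) ^ t₁ ∧ (Literature.NumberTheory.Transcendental.mvPolyHeight P : ℝ) ≤ Real.exp N ∧ ∀ (k : ℕ) (m : Fin l → ℕ), (k : ℝ) ≤ (N : ℝ) ^ s₀ → (∀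 j, (m j : ℝ) ≤ (N : ℝ) ^ s₁) → ‖iteratedDeriv k (fun τ : ℂ => MvPolynomial.aeval ![Complex.exp (∑ j, (m j : ℂ) * t j) * Complex.exp τ, (∏ j, Complex.exp (β * t j) ^ m j) * Complex.exp (β * τ)] P) 0‖ ≤ Real.exp (-(N : ℝ) ^ u)

/-- item stmt-Schanuel-6720 · support · rank 9 · open · by planner
sources: Gelfond1934, Philippon1986, Literature.NumberTheory.Transcendental.Philippon1986_GaGm_holds, Roy2001
[support] rank-1 power criterion on the power-admissible window: (w,βw,2πi,2πiβ) ℚ-independent, v ≠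
0, (b)_β at (e^mw, v^m) ⇒ trdeg ℚ(e^w, v) ≥ 1. Provable now WITHOUT PowThm1BtoA — it is Gel'fond's
proof of α^β read as a criterion: if e^w, v ∈ ℚ̄, Liouville over ℚ(β,e^w,v) (uses u >
max(1,s₀,s₁+t)) turns the small jets into exact zeros, and Philippon's zero estimate with
multiplicities (tree Philippon1986_GaGm_holds with m = 2, X-degree 0, W = ℂ(0,1,β), Σ = points m ≤
N^s₁/3) contradicts s₀+s₁ > 2t (case G′ ⊂ 𝔾ₐ×1) and s₀ > t (case G′ ⊃ a subtorus, transversal to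
(1,β) since β ∉ ℚ). Its truth value is Gelfond–Schneider's; it is the rank-1 rung and the
definition-bug detector of the ladder. [difficulty: provable-now] -/
@[route_item "route-Schanuel-PowerMapCalibration", crux]
def PowCriterionOne : Prop :=
  ∀ β : ℂ, IsAlgebraic ℚ β → β ∉ Set.range ((↑) : ℚ → ℂ) → ∀ (w v : ℂ), LinearIndependent ℚ ![w, β * w, 2 * (Real.pi : ℂ) * Complex.I, 2 * (Real.pi : ℂ) * Complex.I * β] → v ≠ 0 → ∀ (s₀ s₁ t₀ t₁ u : ℝ), 0 < s₁ → 0 < t₀ → 0 < t₁ → max 1 (3 / 2 * max t₀ t₁) < min s₀ (3 * s₁) → max s₀ (s₁ + max t₀ t₁) < u → u < (1 + t₀ + t₁) / 2 → (∀ᶠ N : ℕ in Filter.atTop, ∃ P : MvPolynomial (Fin 2) ℤ, P ≠ 0 ∧ (P.degreeOf 0 : ℝ) ≤ (N : ℝ) ^ t₀ ∧ (P.degreeOf 1 : ℝ) ≤ (N : ℝ) ^ t₁ ∧ (Literature.NumberTheory.Transcendental.mvPolyHeight P : ℝ) ≤ Real.exp N ∧ ∀ k m : ℕ, (k : ℝ)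 ≤ (N : ℝ) ^ s₀ → (m : ℝ) ≤ (N : ℝ) ^ s₁ → ‖iteratedDeriv k (fun τ : ℂ => MvPolynomial.aeval ![Complex.exp w ^ m * Complex.exp τ, v ^ m * Complex.exp (β * τ)] P) 0‖ ≤ Real.exp (-(N : ℝ) ^ u)) → 1 ≤ Algebra.trdeg ℚ ↥(IntermediateField.adjoin ℚ ({Complex.exp w, v} : Set ℂ))

/-- item stmt-Schanuel-6721 · support · rank 9 · open · by planner
sources: Roy2001, doi:10.1006/jnth.2000.2595
[support] for every ℓ, PowCriterion(β,ℓ) ⇒ Power-Schanuel(β,ℓ): given t with (t,βt,2πi,2πiβ)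
ℚ-independent apply the criterion to w := t, v_j := e^βt_j, whose hypothesis holds by
PowAuxConstruction; hence PowCriterionTwo has the advertised content. The converse (Power-Schanuel ⇒
criterion: the criterion is not stronger than its Schanuel shadow) follows from PowThm1BtoA by
Roy2001 §5 1° verbatim (lcm of the d_j, t_j = d w_j + 2πin_j stays (ℚ+ℚβ)-independent thanks to the
2πi-part of the hypothesis) and is left for tenure. [difficulty: provable-now] -/
@[route_item "route-Schanuel-PowerMapCalibration", crux]
def PowCriterionImpPowerSchanuel : Prop :=
  ∀ β : ℂ, IsAlgebraic ℚ β → β ∉ Set.range ((↑) : ℚ → ℂ) → ∀ l : ℕ, (∀ (w v : Fin l → ℂ), LinearIndependent ℚ (Fin.append (Fin.append w (fun j => β * w j)) ![2 * (Real.pi : ℂ) * Complex.I, 2 * (Real.pi : ℂ) * Complex.I * β]) → (∀ j, v j ≠ 0) → ∀ (s₀ s₁ t₀ t₁ u : ℝ), 0 < s₁ → 0 < t₀ → 0 < t₁ → max 1 (3 / 2 * max t₀ t₁) < min s₀ (3 * s₁) → max s₀ (s₁ + max t₀ t₁) < u → u < (1 + t₀ + t₁) / 2 → (∀ᶠ N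 : ℕ in Filter.atTop, ∃ P : MvPolynomial (Fin 2) ℤ, P ≠ 0 ∧ (P.degreeOf 0 : ℝ) ≤ (N : ℝ) ^ t₀ ∧ (P.degreeOf 1 : ℝ) ≤ (N : ℝ) ^ t₁ ∧ (Literature.NumberTheory.Transcendental.mvPolyHeight P : ℝ) ≤ Real.exp N ∧ ∀ (k : ℕ) (m : Fin l → ℕ), (k : ℝ) ≤ (N : ℝ) ^ s₀ → (∀ j, (m j : ℝ) ≤ (N : ℝ) ^ s₁) → ‖iteratedDeriv k (fun τ : ℂ => MvPolynomial.aeval ![Complex.exp (∑ j, (m j : ℂ) * w j) * Complex.exp τ, (∏ j, v j ^ m j) * Complex.exp (β * τ)] P) 0‖ ≤ Real.exp (-(N : ℝ) ^ u)) → (l : Cardinal) ≤ Algebra.trdeg ℚ ↥(IntermediateField.adjoin ℚ (Set.range (Complex.exp ∘ w) ∪ Set.range v))) → ∀ (t : Fin l → ℂ), LinearIndependent ℚ (Fin.append (Fin.append t (fun j => β * t j)) ![2 * (Real.pi : ℂ) * Complex.I, 2 * (Real.pi : ℂ) * Complex.I * β]) → (l : Cardinal) ≤ Algebra.trdeg ℚ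 ↥(IntermediateField.adjoin ℚ (Set.range (Complex.exp ∘ t) ∪ Set.range (fun j => Complex.exp (β * t j))))

/-- item stmt-Schanuel-6722 · support · rank 9 · open · by planner
sources: Lang1966, Waldschmidt2004, BaysKirbyWilkie2010
[support] Schanuel ⇒ Power-Schanuel(β,ℓ) for every algebraic irrational β and every ℓ: apply
Schanuel to the 2ℓ numbers (t, βt) and remove t (ℓ generators) and βt (algebraic over ℚ(t,β)).
Certifies that each rung is a Schanuel consequence, so a refutation of PowCriterionTwo not traced to
the window refutes the summit; the generic-power analogue is a theorem (BaysKirbyWilkie2010 Thm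
1.2), the far end of the dial. [difficulty: provable-now] -/
@[route_item "route-Schanuel-PowerMapCalibration", crux]
def PowerSchanuelOfSchanuel : Prop :=
  Schanuel → ∀ β : ℂ, IsAlgebraic ℚ β → β ∉ Set.range ((↑) : ℚ → ℂ) → ∀ (l : ℕ) (t : Fin l → ℂ), LinearIndependent ℚ (Fin.append (Fin.append t (fun j => β * t j)) ![2 * (Real.pi : ℂ) * Complex.I, 2 * (Real.pi : ℂ) * Complex.I * β]) → (l : Cardinal) ≤ Algebra.trdeg ℚ ↥(IntermediateField.adjoin ℚ (Set.range (Complex.exp ∘ t) ∪ Set.range (fun j => Complex.exp (β * t j))))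

/-- item stmt-Schanuel-6723 · support · rank 9 · open · by planner
sources: Gelfond1934, Literature.NumberTheory.Transcendental.gelfond_schneider_holds
[support] Power-Schanuel(β,1): (t,βt,2πi,2πiβ) ℚ-independent ⇒ e^t and e^βt are not both algebraic —
Gelfond–Schneider in logarithmic form, from the tree fact gelfond_schneider (PROVED,
gelfond_schneider_holds via baker_holds) plus trdeg = 0 ↔ algebraic for a finitely generated adjoin.
[difficulty: provable-now] -/
@[route_item "route-Schanuel-PowerMapCalibration", crux]
def PowerSchanuelOne : Prop :=
  ∀ β : ℂ, IsAlgebraic ℚ β → β ∉ Set.range ((↑) : ℚ → ℂ) → ∀ (t : Fin 1 → ℂ), LinearIndependent ℚ (Fin.append (Fin.append t (fun j => β * t j)) ![2 * (Real.pi : ℂ) * Complex.I, 2 * (Real.pi : ℂ) * Complex.I * β]) → (1 : Cardinal) ≤ Algebra.trdeg ℚ ↥(IntermediateField.adjoin ℚ (Set.range (Complex.exp ∘ t) ∪ Set.range (fun j => Complex.exp (β * t j))))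

-- earlier Assembly (stmt-Schanuel-6724, replaced 2026-08-15T12:32:21Z -> stmt-Schanuel-8196): retired by None — PowThm1BtoA → PowCriterionTwo → PowOnePointRoyGap → RoyConjectureTwo → Schanuel
/-- item stmt-Schanuel-8196 · assembly · rank 1 · open · by planner
sources: Roy2001, Literature.NumberTheory.Transcendental.Roy2001_iff_holds
[assembly] PowThm1BtoA → PowCriterionTwo → PowOnePointRoyGap → (∀ n, RoyCriterion n) [=
RoyConjectureTwo, the target shared with route RoyCriterion] → Schanuel; only the last arrow is
logical (Roy2001_iff_holds, sorry-free in tree: fun hR n => (Roy2001_iff_holds n).mp (hR n)); the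
three cruxes ride as leading hypotheses to record the calibration chain (D-0019: alternative
decomposition sharing the target decl). Sources: Roy2001,
Literature.NumberTheory.Transcendental.Roy2001_iff_holds -/
@[route_item "route-Schanuel-PowerMapCalibration", crux]
def Assembly : Prop :=
  PowThm1BtoA → PowCriterionTwo → PowOnePointRoyGap → (∀ n, Literature.NumberTheory.Transcendental.RoyCriterion n) → Schanuel

/-! D-0027 §2.1 — DECIDING THEOREM (planner-authored via `route open/edit --closes-file`; by planner-rbadge-Schanuel-PowerMapCalibration-9ac13232-g2-0 2026-08-15T16:19:25Z):
its hypotheses are this route's items and its conclusion the sub-problem Statement (glue_lint), and it elaborates with this file. -/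

/-- D-0027 §2.1 deciding theorem of route `PowerMapCalibration`. Hypotheses = all ten listed items, by name;
conclusion = `_root_.Schanuel` by name. Logically load-bearing are the shared target `RoyConjectureTwo`
(definitionally `∀ n, RoyCriterion n`, Roy 2001 Conjecture 2 for every rank; item shared with route RoyCriterion) and
`Assembly : PowThm1BtoA → PowCriterionTwo → PowOnePointRoyGap → (∀ n, RoyCriterion n) → Schanuel`, which is fed the
three ranked cruxes and the target; the five support items (calibration ladder on the power face 𝔾ₘ², see the route
header) ride along unused. `Assembly` itself is provable now from the tree theorem
`Literature.NumberTheory.Transcendental.schanuelRank_of_royCriterion'` (Roy 2001 §5, 2°). -/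
@[closes "route-Schanuel-PowerMapCalibration"] theorem closes : RoyConjectureTwo → PowCriterionTwo → PowThm1BtoA → PowOnePointRoyGap → PowAuxConstruction →
    PowCriterionOne → PowCriterionImpPowerSchanuel → PowerSchanuelOfSchanuel → PowerSchanuelOne → Assembly →
    _root_.Schanuel :=
  fun hRoy hC2 hT1 hGap _hAux _hC1 _hImp _hOfS _hPS1 hA => hA hT1 hC2 hGap hRoy

end Summit.Schanuel.Schanuel.Theses.PowerMapCalibration
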